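import Mathlib.Analysis.Calculus.ContDiff.RCLike
import Mathlib.Analysis.Calculus.ContDiff.Comp
import Mathlib.Analysis.Calculus.Deriv.MeanValue
import Mathlib.Analysis.Calculus.LocalExtr.Basic
import HarnessLib

/-!
# NE7QuadraticGrowthSecondDerivative — QUADRATIC GROWTH AT A MINIMUM MAKES THE SECOND DERIVATIVE COERCIVE: for `f : E → ℝ` of class `C²` at `x₀` with `c‖x − x₀‖² ≤ f x − f x₀` near `x₀`
# (`c ≥ 0`), the iterated Fréchet derivative satisfies `c‖v‖² ≤ (D²f(x₀) v) v` for every direction `v` — the letter that turns gen 113's quadratic growth of the action off the minimal orbit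
# (✓ p819664) into NON-DEGENERACY of the slice Hessian, the hypothesis of the implicit-function rung (C¹ dependence of `U_k(V)` on `V`, ROAD-G114 §6 next (i))

Cell `pub-balaban`, rung (B)+1 sub-cell t4, lineage `b2b-balaban-t4-ne7-p1` (CRUX PROVER NE7 #1 = OWNER of BINDER row NE7), generation 114.  Memo `t4/b2b-balaban-t4-ne7-p1-g114/ROAD-G114.md` §6.
THE ARGUMENT (along the line `t ↦ x₀ + t•v`): `φ(t) = f(x₀ + tv)` has `φ′(t) = Df(x₀+tv)v` near `0` and `φ′` has derivative `L = (D²f(x₀)v)v` at `0`, `φ′(0) = 0` (local minimum); if `L < c‖v‖²`,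
then `φ′(ξ) ≤ (c‖v‖² − δ)ξ` for small `ξ > 0` (`δ > 0`), and the mean value theorem `φ(t) − φ(0) = φ′(ξ)t`, `ξ ∈ (0,t)`, contradicts `φ(t) − φ(0) ≥ c‖v‖²t²`.  (The sharp constant `2c` is not
needed downstream and not claimed.)
WHAT ([folklore]; 0 def, 0 sorry; any real normed space).  **`second_derivative_ge_of_quadratic_growth`**.
HONEST FRAMING (page 1): elementary calculus; nothing of Bałaban's; a letter for the next rung; NOT NE7, NOT NE3; spine 0∕9; finite T⁴ rung (B)+1 — NOT infinite volume, NOT mass gap, NOT BetaPertH, NOT Clay.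
-/

set_option autoImplicit false

open scoped Topology
open Set Filter Metric

namespace Summit.QuantumFields.BalabanUV.T4Continuum.NE7QuadraticGrowthSecondDerivative

variable {E : Type*} [NormedAddCommGroup E] [NormedSpace ℝ E]

/-- **QUADRATIC GROWTH ⇒ COERCIVE SECOND DERIVATIVE.**  `f : E → ℝ` of class `C²` at `x₀`, `0 ≤ c`, and `c‖x − x₀‖² ≤ f x − f x₀` for `x` near `x₀` ⟹ for every `v : E`,
`c‖v‖² ≤ (fderiv ℝ (fderiv ℝ f) x₀ v) v`. [folklore] -/
theorem second_derivative_ge_of_quadratic_growth {f : E → ℝ} {x₀ : E} {c : ℝ} (hf : ContDiffAt ℝ 2 f x₀) (hc : 0 ≤ c)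
    (hgrowth : ∀ᶠ x in 𝓝 x₀, c * ‖x - x₀‖ ^ 2 ≤ f x - f x₀) (v : E) :
    c * ‖v‖ ^ 2 ≤ (fderiv ℝ (fderiv ℝ f) x₀ v) v := by
  -- differentiability near `x₀`, and of `fderiv f` at `x₀`
  have hev : ∀ᶠ y in 𝓝 x₀, ContDiffAt ℝ 2 f y := hf.eventually (by simp)
  have hd2 : DifferentiableAt ℝ (fderiv ℝ f) x₀ := (ContDiffAt.fderiv_right (m := 1) hf (by norm_num)).differentiableAt (by norm_num)
  -- the line `ℓ(t) = x₀ + t•v` and the restriction `φ = f ∘ ℓ`, its derivative `ψ`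
  set ℓ : ℝ → E := fun t => x₀ + t • v with hℓ
  have hℓd : ∀ t, HasDerivAt ℓ v t := fun t => by
    have h := ((hasDerivAt_id t).smul_const v).const_add x₀
    simpa [hℓ] using h
  have hℓ0 : ℓ 0 = x₀ := by simp [hℓ]
  have hℓc : Tendsto ℓ (𝓝 0) (𝓝 x₀) := by
    have h := (hℓd 0).continuousAt.tendsto; rwa [hℓ0] at h
  set φ : ℝ → ℝ := fun t => f (ℓ t) with hφ
  set ψ : ℝ → ℝ := fun t => fderiv ℝ f (ℓ t) v with hψ
  have hφd : ∀ᶠ t in 𝓝 (0 : ℝ), HasDerivAt φ (ψ t) t := by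
    filter_upwards [hℓc.eventually hev] with t ht
    have hdf : HasFDerivAt f (fderiv ℝ f (ℓ t)) (ℓ t) := (ht.differentiableAt (by norm_num)).hasFDerivAt
    exact hdf.comp_hasDerivAt t (hℓd t)
  -- `ψ` has derivative `L = (D²f(x₀)v)v` at `0`, and `ψ 0 = 0`
  set L : ℝ := (fderiv ℝ (fderiv ℝ f) x₀ v) v with hL
  have hψd : HasDerivAt ψ L 0 := by
    have h1 : HasFDerivAt (fderiv ℝ f) (fderiv ℝ (fderiv ℝ f) x₀) (ℓ 0) := by rw [hℓ0]; exact hd2.hasFDerivAt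
    have h2 : HasDerivAt (fun t => fderiv ℝ f (ℓ t)) (fderiv ℝ (fderiv ℝ f) x₀ v) 0 := h1.comp_hasDerivAt 0 (hℓd 0)
    have h3 := h2.clm_apply (hasDerivAt_const (0 : ℝ) v)
    simpa [hψ, hL] using h3
  have hmin : IsLocalMin f x₀ := by
    filter_upwards [hgrowth] with x hx
    nlinarith [norm_nonneg (x - x₀), sq_nonneg ‖x - x₀‖]
  have hψ0 : ψ 0 = 0 := by
    simp only [hψ, hℓ0, hmin.fderiv_eq_zero, zero_apply]
  -- growth along the line
  have hgrowthφ : ∀ᶠ t in 𝓝 (0 : ℝ), c * ‖v‖ ^ 2 * t ^ 2 ≤ φ t - φ 0 := by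
    filter_upwards [hℓc.eventually hgrowth] with t ht
    have e : ℓ t - x₀ = t • v := by simp [hℓ]
    rw [e, norm_smul, Real.norm_eq_abs, mul_pow, sq_abs] at ht
    simpa [hφ, hℓ0, mul_comm, mul_left_comm, mul_assoc] using ht
  -- suppose `L < c‖v‖²`
  by_contra hlt
  rw [not_le] at hlt
  set δ : ℝ := (c * ‖v‖ ^ 2 - L) / 2 with hδ
  have hδ0 : 0 < δ := by rw [hδ]; linarith
  -- `ψ t ≤ (L + δ) t` for small `t > 0` (little-o of the derivative)
  have hψo : ∀ᶠ t in 𝓝 (0 : ℝ), |ψ t - t * L| ≤ δ * |t| := by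
    have h := (hasDerivAt_iff_isLittleO.mp hψd).def hδ0
    filter_upwards [h] with t ht
    simpa [hψ0, Real.norm_eq_abs, smul_eq_mul] using ht
  -- collect the eventual facts on a small interval `[0, t₀]`
  obtain ⟨r, hr, hball⟩ := Metric.mem_nhds_iff.mp (hφd.and (hgrowthφ.and hψo))
  set t₀ : ℝ := r / 2 with ht₀
  have ht₀0 : 0 < t₀ := by positivity
  have hIn : ∀ s ∈ Icc (0 : ℝ) t₀, s ∈ Metric.ball (0 : ℝ) r := fun s hs => by
    rw [Metric.mem_ball, Real.dist_eq, sub_zero, abs_of_nonneg hs.1]; linarith [hs.2]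
  -- mean value theorem on `[0, t₀]`
  have hcont : ContinuousOn φ (Icc 0 t₀) := fun s hs => ((hball (hIn s hs)).1).continuousAt.continuousWithinAt
  have hderiv : ∀ s ∈ Ioo (0 : ℝ) t₀, HasDerivAt φ (ψ s) s := fun s hs => (hball (hIn s ⟨hs.1.le, hs.2.le⟩)).1
  obtain ⟨ξ, hξ, hslope⟩ := exists_hasDerivAt_eq_slope φ ψ ht₀0 hcont hderiv
  have hξball := hball (hIn ξ ⟨hξ.1.le, hξ.2.le⟩)
  have hψξ : ψ ξ ≤ (L + δ) * ξ := by
    have h := hξball.2.2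
    rw [abs_of_pos hξ.1] at h
    have := (abs_le.mp h).2
    linarith
  have hgt := (hball (hIn t₀ ⟨ht₀0.le, le_rfl⟩)).2.1
  -- `φ t₀ − φ 0 = ψ ξ · t₀ ≤ (L+δ) ξ t₀ < c‖v‖² t₀²`
  have heq : φ t₀ - φ 0 = ψ ξ * t₀ := by
    rw [hslope, sub_zero, div_mul_cancel₀ _ ht₀0.ne']
  have hLδ : L + δ < c * ‖v‖ ^ 2 := by rw [hδ]; linarith
  have h1 : ψ ξ * t₀ ≤ (L + δ) * ξ * t₀ := by nlinarith
  have h2 : (L + δ) * ξ * t₀ < c * ‖v‖ ^ 2 * t₀ ^ 2 := by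
    rcases le_or_gt 0 (L + δ) with hpos | hneg
    · have h3 : (L + δ) * ξ ≤ (L + δ) * t₀ := mul_le_mul_of_nonneg_left hξ.2.le hpos
      nlinarith [mul_pos ht₀0 ht₀0]
    · have h3 : (L + δ) * ξ * t₀ < 0 := by
        have := mul_neg_of_neg_of_pos hneg hξ.1; nlinarith
      have h4 : 0 ≤ c * ‖v‖ ^ 2 * t₀ ^ 2 := by positivity
      linarith
  linarith

end Summit.QuantumFields.BalabanUV.T4Continuum.NE7QuadraticGrowthSecondDerivative
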